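import Summits.QuantumFields.YangMills.Theorems.UnitScaleTiltFluctuationComparisonRegPrDualWhitney3DCurl

/-!
# Route `UnitScaleTilt` — crux K1bR-pr `FluctuationComparisonRegPr` (stmt-QuantumFields-19201), stub `stub_oneStepSmallLift`
# (W7 line), piece (L1) FOR EVERY ODD BLOCK SIZE: the GAUGE LAYER of the dual Whitney lift — gradients, block means,
# the blockwise-constant extension and the face section in the `ℤ³` cochain model
# (support file `--supports stmt-QuantumFields-19201`; sequel of `…DualWhitney3DCurl`; cell `ym3-torus`, seat `ym3-torus-p1` gen 10; memo UV3-NODE §19.2)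

Vocabulary and identities needed to turn the dual Whitney lift `R₁` (`Sline_R1`, `d1_R1`) into the gauge-blind, S-neutral operator
`Z = R₁ − d₀K − faceSec` of UV3-NODE §19.2 (what the covariant exponentiation (L2) feeds with block-local axial-gauge logarithms):
* `d0` (gradient of a 0-cochain, fine or coarse), `Eext` (blockwise-constant extension), `faceSec` (the linear face section: `v(B;a)` on
  the bonds leaving block `B` in direction `a`), `Qmean` (block mean), `wt0`/`R0` (the 0-form tensor interpolant `Σ_y Φ₀Φ₀Φ₀·g(y)`);
* PROVED: `d1_d0` (`d₁∘d₀ = 0`), `d0_Eext` (`d₀∘E = faceSec∘d₀`), `Sline_d0` (`S∘d₀^fine = d₀^coarse∘Q`: the line average of a fine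
  gradient is the coarse gradient of the block means), `Sline_faceSec` (`S∘faceSec = 1`: each averaging line crosses exactly one exit
  bond), `sum_wt0_eq_one` (partition of unity of the 0-form weights, from `phi0_pu`).
The remaining identities of §19.2 (`K∘d₀ = R₀ − E`, `R₁∘d₀ = d₀∘R₀`, `Q∘K = 0`) follow the patterns of `d1_R1`/`sum_wt1_apt` and are
left to the sequel.  Elementary finite sums; nothing of Bałaban's is asserted.
-/

noncomputable section


namespace Summit.QuantumFields.YangMills.Theorems.DualWhitney

open Finset

variable {E : Type*} [NormedAddCommGroup E] [NormedSpace ℝ E]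
variable (h : ℕ)

/-! ## §13 Gradients, extension, face section, block mean -/

/-- The gradient of a 0-cochain (fine or coarse): `(d₀f)(x;a) = f(x + e_a) − f(x)`. -/
def d0 (f : Site → E) (x : Site) (a : Fin 3) : E := f (x + unit a) - f x

omit [NormedSpace ℝ E] in
/-- `d₁ ∘ d₀ = 0`. -/
theorem d1_d0 (f : Site → E) (z : Site) (μ ν : Fin 3) : d1 (d0 f) z μ ν = 0 := by
  unfold d1 d0
  rw [add_right_comm z (unit ν) (unit μ)]
  abel

/-- The blockwise-constant extension of a coarse 0-cochain: `(Eg)(x) = g(blk x)`. -/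
def Eext (g : Site → E) (x : Site) : E := g (blk h x)

/-- A fine bond `(x, x + e_a)` EXITS its block iff the block index changes (then by `+1` in direction `a` only). -/
abbrev Exits (x : Site) (a : Fin 3) : Prop := blk h (x + unit a) a ≠ blk h x a

/-- THE LINEAR FACE SECTION: `v(blk x; a)` on the exit bonds in direction `a`, `0` on interior bonds. -/
def faceSec (v : Site → Fin 3 → E) (x : Site) (a : Fin 3) : E := if Exits h x a then v (blk h x) a else 0

/-- In the directions `b ≠ a` the block index does not change under `x ↦ x + e_a`. -/
theorem blk_add_unit_ne (x : Site) {a b : Fin 3} (hba : b ≠ a) : blk h (x + unit a) b = blk h x b := by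
  unfold blk; simp [unit_apply, hba]

/-- The block of `x + e_a`: `blk x + e_a` on an exit bond, `blk x` otherwise. -/
theorem blk_add_unit_eq (x : Site) (a : Fin 3) :
    blk h (x + unit a) = if Exits h x a then blk h x + unit a else blk h x := by
  have hb := blk_add_unit h x a a
  funext b
  by_cases hba : b = a
  · subst hba
    split_ifs with he
    · unfold Exits at he; simp only [Pi.add_apply, unit_apply, if_true]; omega
    · unfold Exits at he; push Not at he; simp only [he]
  · rw [blk_add_unit_ne h x hba]
    split_ifs <;> simp [unit_apply, hba]

omit [NormedSpace ℝ E] in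
/-- **`d₀ ∘ E = faceSec ∘ d₀`**: the fine gradient of a blockwise-constant function lives on the exit bonds, where it is the
coarse gradient. -/
theorem d0_Eext (g : Site → E) (x : Site) (a : Fin 3) : d0 (Eext h g) x a = faceSec h (d0 g) x a := by
  have hb := blk_add_unit_eq h x a
  unfold faceSec
  by_cases he : Exits h x a
  · rw [if_pos he] at hb ⊢
    unfold d0 Eext; rw [hb]
  · rw [if_neg he] at hb ⊢
    unfold d0 Eext; rw [hb, sub_self]

/-- THE BLOCK MEAN of a fine 0-cochain: `(Qf)(y) = L⁻³ Σ_{i∈[0,L)³} f(Ly − h + i)`. -/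
def Qmean (f : Site → E) (y : Site) : E := ((bL h : ℝ) ^ 3)⁻¹ • ∑ i ∈ box h, f (apt h y 0 i 0)

/-- The averaging geometry: `apt y μ i 0` does not depend on `μ`, and one step along the line is `+ e_μ`. -/
theorem apt_zero (y : Site) (μ : Fin 3) (i : Fin 3 → ℕ) : apt h y μ i 0 = apt h y 0 i 0 := by
  funext a; unfold apt; simp

/-- One step along the averaging line. -/
theorem apt_succ (y : Site) (μ : Fin 3) (i : Fin 3 → ℕ) (t : ℕ) : apt h y μ i (t + 1) = apt h y μ i t + unit μ := by
  funext a; unfold apt; simp only [Pi.add_apply, unit_apply]; split_ifs <;> push_cast <;> ring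

/-- After `L` steps the line reaches the same position of the next block. -/
theorem apt_bL (y : Site) (μ : Fin 3) (i : Fin 3 → ℕ) : apt h y μ i (bL h) = apt h (y + unit μ) μ i 0 := by
  funext a; unfold apt; simp only [Pi.add_apply, unit_apply]; split_ifs <;> push_cast <;> ring

/-- **`S ∘ d₀^fine = d₀^coarse ∘ Q`**: the line average of a fine gradient telescopes to the coarse gradient of the block means. -/
theorem Sline_d0 (f : Site → E) (y : Site) (μ : Fin 3) : Sline h (d0 f) y μ = d0 (Qmean h f) y μ := by
  unfold Sline d0 Qmean
  have tele : ∀ i ∈ box h, ∑ t ∈ range (bL h), (f (apt h y μ i t + unit μ) - f (apt h y μ i t))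
      = f (apt h (y + unit μ) 0 i 0) - f (apt h y 0 i 0) := by
    intro i _
    have := sum_range_sub (fun t => f (apt h y μ i t)) (bL h)
    simp only [← apt_succ] 
    rw [this, apt_bL, apt_zero, apt_zero h y]
  rw [sum_congr rfl tele, sum_sub_distrib, smul_sub]


/-- Along the averaging line from `Ly − h + i` in direction `μ`, the `t`-th bond exits its block iff `i_μ + t = 2h`. -/
theorem exits_apt_iff {y : Site} {μ : Fin 3} {i : Fin 3 → ℕ} {t : ℕ} (hi : i ∈ box h) (ht : t ∈ range (bL h)) :
    Exits h (apt h y μ i t) μ ↔ i μ + t = 2 * h := by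
  have hL : (0 : ℤ) < bL h := by rw [bL_int]; omega
  have hiμ : i μ < bL h := by
    unfold box at hi; rw [Fintype.mem_piFinset] at hi; exact mem_range.mp (hi μ)
  have ht' : t < bL h := mem_range.mp ht
  unfold Exits blk
  simp only [Pi.add_apply, unit_apply, if_true]
  unfold apt
  simp only [if_true]
  have e1 : (bL h : ℤ) * y μ - h + (i μ : ℕ) + (t : ℤ) + 1 + h = ((i μ : ℤ) + t + 1) + y μ * (bL h : ℤ) := by ring
  have e2 : (bL h : ℤ) * y μ - h + (i μ : ℕ) + (t : ℤ) + h = ((i μ : ℤ) + t) + y μ * (bL h : ℤ) := by ring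
  rw [e1, e2, Int.add_mul_ediv_right _ _ hL.ne', Int.add_mul_ediv_right _ _ hL.ne']
  have hL2 := bL_int h
  unfold bL at hiμ ht'
  constructor
  · intro hne
    by_contra hc
    apply hne
    congr 1
    rcases lt_or_gt_of_ne hc with hlt | hgt
    · rw [Int.ediv_eq_zero_of_lt (by omega) (by rw [hL2]; omega), Int.ediv_eq_zero_of_lt (by omega) (by rw [hL2]; omega)]
    · have h1 : ((i μ : ℤ) + t + 1) / (bL h : ℤ) = 1 := by
        rw [Int.ediv_eq_iff_of_pos hL]; rw [hL2]; constructor <;> omega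
      have h2 : ((i μ : ℤ) + t) / (bL h : ℤ) = 1 := by
        rw [Int.ediv_eq_iff_of_pos hL]; rw [hL2]; constructor <;> omega
      rw [h1, h2]
  · intro heq hc
    have h1 : ((i μ : ℤ) + t + 1) / (bL h : ℤ) = 1 := by
      rw [Int.ediv_eq_iff_of_pos hL]; rw [hL2]; constructor <;> omega
    have h2 : ((i μ : ℤ) + t) / (bL h : ℤ) = 0 := Int.ediv_eq_zero_of_lt (by omega) (by rw [hL2]; omega)
    rw [h1, h2] at hc
    omega


/-- **`S ∘ faceSec = 1`**: every averaging line crosses exactly one exit bond of its direction, so the line average of the face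
section of `v` is `v`. -/
theorem Sline_faceSec (v : Site → Fin 3 → E) (y : Site) (μ : Fin 3) : Sline h (faceSec h v) y μ = v y μ := by
  have hL := bL_pos h
  unfold Sline
  have inner : ∀ i ∈ box h, ∑ t ∈ range (bL h), faceSec h v (apt h y μ i t) μ = v y μ := by
    intro i hi
    have hiμ : i μ < bL h := by
      unfold box at hi; rw [Fintype.mem_piFinset] at hi; exact mem_range.mp (hi μ)
    unfold bL at hiμ
    have hblk : ∀ t ∈ range (bL h), Exits h (apt h y μ i t) μ → blk h (apt h y μ i t) = y := by
      intro t ht he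
      rw [exits_apt_iff h hi ht] at he
      have hb := blk_apt_mem h (y := y) (μ := μ) hi ht
      have hb2 := blk_apt_mem h (y := y) (μ := μ) hi ht μ
      funext a
      by_cases ha : a = μ
      · subst ha
        -- at the exit position the block index is still `y μ`: `(i μ + t + h)/L = (2h + h)... ` computed directly
        have hLi : (0 : ℤ) < bL h := by rw [bL_int]; omega
        unfold blk apt
        simp only [if_true]
        have e2 : (bL h : ℤ) * y a - h + (i a : ℕ) + (t : ℤ) + h = ((i a : ℤ) + t) + y a * (bL h : ℤ) := by ring
        rw [e2, Int.add_mul_ediv_right _ _ hLi.ne', Int.ediv_eq_zero_of_lt (by omega) (by rw [bL_int]; omega)]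
        ring
      · have := hb a
        unfold blk apt at this ⊢
        simp only [ha, if_false, add_zero] at this ⊢
        have hLi : (0 : ℤ) < bL h := by rw [bL_int]; omega
        have hia : i a < bL h := by
          unfold box at hi; rw [Fintype.mem_piFinset] at hi; exact mem_range.mp (hi a)
        have e2 : (bL h : ℤ) * y a - h + (i a : ℕ) + h = (i a : ℤ) + y a * (bL h : ℤ) := by ring
        rw [e2, Int.add_mul_ediv_right _ _ hLi.ne', Int.ediv_eq_zero_of_lt (by omega) (by exact_mod_cast hia)]
        ring
    -- exactly one `t` (namely `2h − i μ`) exits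
    rw [← sum_filter_add_sum_filter_not (range (bL h)) (fun t => Exits h (apt h y μ i t) μ)]
    have hone : (range (bL h)).filter (fun t => Exits h (apt h y μ i t) μ) = {2 * h - i μ} := by
      ext t
      simp only [mem_filter, mem_range, mem_singleton]
      constructor
      · rintro ⟨ht, he⟩
        rw [exits_apt_iff h hi (mem_range.mpr ht)] at he; omega
      · intro ht
        have ht' : t < bL h := by unfold bL; omega
        exact ⟨ht', (exits_apt_iff h hi (mem_range.mpr ht')).mpr (by omega)⟩
    rw [hone, sum_singleton]
    have hzero : ∑ t ∈ (range (bL h)).filter (fun t => ¬ Exits h (apt h y μ i t) μ), faceSec h v (apt h y μ i t) μ = 0 :=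
      sum_eq_zero fun t ht => by
        rw [mem_filter] at ht
        unfold faceSec; rw [if_neg ht.2]
    rw [hzero, add_zero]
    have ht0 : 2 * h - i μ ∈ range (bL h) := mem_range.mpr (by unfold bL; omega)
    have hex : Exits h (apt h y μ i (2 * h - i μ)) μ := (exits_apt_iff h hi ht0).mpr (by omega)
    unfold faceSec; rw [if_pos hex, hblk _ ht0 hex]
  rw [sum_congr rfl inner, sum_const]
  unfold box
  rw [Fintype.card_piFinset, prod_const, card_range, card_univ, Fintype.card_fin, ← Nat.cast_smul_eq_nsmul ℝ, smul_smul]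
  have : ((bL h : ℝ) ^ 3)⁻¹ * ((bL h ^ 3 : ℕ) : ℝ) = 1 := by push_cast; field_simp
  rw [this, one_smul]


/-! ## §14 The 0-form interpolant and its partition of unity -/

/-- The tensor weight of the 0-form interpolant: `Φ₀` in all three directions. -/
def wt0 (z y : Site) : ℝ := ∏ a, phi0 h (z a - bL h * y a)

/-- THE 0-FORM INTERPOLANT `(R₀g)(x) = Σ_y Φ₀Φ₀Φ₀(x − Ly)·g(y)`. -/
def R0 (g : Site → E) (x : Site) : E := ∑ y ∈ win h x, wt0 h x y • g y

/-- `wt0` vanishes off the radius-1 box. -/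
theorem wt0_eq_zero {z y : Site} (hy : y ∉ supp1 h z) : wt0 h z y = 0 := by
  obtain ⟨a, ha⟩ := exists_far_of_not_mem_supp1 h hy
  unfold wt0
  have := factor_eq_zero h ha False
  simp only [if_false] at this
  exact prod_eq_zero (mem_univ a) this

/-- **PARTITION OF UNITY** of the 0-form weights: `Σ_y wt0(x, y) = 1` (from `phi0_pu`). -/
theorem sum_wt0_eq_one (x : Site) : ∑ y ∈ win h x, wt0 h x y = 1 := by
  have hsub : ∑ y ∈ win h x, wt0 h x y = ∑ y ∈ supp1 h x, wt0 h x y := by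
    symm; exact sum_subset (supp1_subset_win h x) fun y _ hy => wt0_eq_zero h hy
  rw [hsub]
  calc ∑ y ∈ supp1 h x, wt0 h x y
      = ∏ a : Fin 3, ∑ w ∈ Icc (blk h x a - 1) (blk h x a + 1), phi0 h (x a - bL h * w) := by
        unfold supp1 wt0; rw [prod_univ_sum]
    _ = ∏ _a : Fin 3, (1 : ℝ) := by
        refine prod_congr rfl fun a _ => ?_
        obtain ⟨r, hr1, hr2, hz⟩ := blk_decomp h x a
        rw [sum_Icc_three]
        have e1 : x a - bL h * (blk h x a - 1) = r + bL h := by rw [hz]; ring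
        have e2 : x a - bL h * blk h x a = r := by rw [hz]; ring
        have e3 : x a - bL h * (blk h x a + 1) = r - bL h := by rw [hz]; ring
        rw [e1, e2, e3]
        linarith [phi0_pu h hr1 hr2]
    _ = 1 := by simp

/-! ## §15 Path sums and the gauge potential `K` -/

/-- One segment of a lattice path: the value of the 1-cochain `v` picked up when moving from `p` by `s ∈ {−1, 0, 1}` steps in
direction `a` (`0` for any other `s`). -/
def seg (v : Site → Fin 3 → E) (p : Site) (a : Fin 3) (s : ℤ) : E :=
  if s = 1 then v p a else if s = -1 then -(v (p - unit a) a) else 0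

/-- The sum of `v` along the axis-ordered lattice path from `p` to `p + j` (`j ∈ {−1,0,1}³`; junk otherwise). -/
def pathsum (v : Site → Fin 3 → E) (p j : Site) : E :=
  seg v p 0 (j 0) + seg v (p + j 0 • unit 0) 1 (j 1) + seg v (p + j 0 • unit 0 + j 1 • unit 1) 2 (j 2)

omit [NormedSpace ℝ E] in
/-- A segment of a gradient telescopes. -/
theorem seg_d0 (g : Site → E) (p : Site) (a : Fin 3) {s : ℤ} (hs : s = -1 ∨ s = 0 ∨ s = 1) :
    seg (d0 g) p a s = g (p + s • unit a) - g p := by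
  unfold seg d0
  rcases hs with rfl | rfl | rfl
  · simp only [show (-1 : ℤ) ≠ 1 by decide, if_false, if_true, neg_sub, neg_smul, one_smul]
    rw [sub_add_cancel]; rfl
  · simp
  · simp

omit [NormedSpace ℝ E] in
/-- **Path sums of gradients telescope**: `pathsum (d₀g) p j = g(p + j) − g(p)` for `j ∈ {−1,0,1}³`. -/
theorem pathsum_d0 (g : Site → E) (p j : Site) (hj : ∀ a, j a = -1 ∨ j a = 0 ∨ j a = 1) :
    pathsum (d0 g) p j = g (p + j) - g p := by
  unfold pathsum
  rw [seg_d0 g _ 0 (hj 0), seg_d0 g _ 1 (hj 1), seg_d0 g _ 2 (hj 2)]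
  have : p + j = p + j 0 • unit 0 + j 1 • unit 1 + j 2 • unit 2 := by
    funext a; simp only [Pi.add_apply, Pi.smul_apply, unit_apply, smul_eq_mul]
    fin_cases a <;> simp
  rw [this]; abel

/-- THE GAUGE POTENTIAL `(Kv)(x) = Σ_y (wt0(x,y) − [y = blk x])·pathsum_{blk x → y}(v)` (UV3-NODE §19.2). -/
def K (v : Site → Fin 3 → E) (x : Site) : E :=
  ∑ y ∈ win h x, (wt0 h x y - if y = blk h x then 1 else 0) • pathsum v (blk h x) (y - blk h x)

/-- The block of `x` lies in its own window. -/
theorem blk_mem_win (x : Site) : blk h x ∈ win h x := by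
  unfold win; rw [Fintype.mem_piFinset]; intro a; rw [mem_Icc]; omega

/-- **`K ∘ d₀ = R₀ − E`**: on a pure coarse gauge the potential `K` returns the interpolant minus the blockwise-constant extension
(uses the partition of unity). -/
theorem K_d0 (g : Site → E) (x : Site) : K h (d0 g) x = R0 h g x - Eext h g x := by
  unfold K R0 Eext
  have hcoef : ∀ y ∈ win h x, (wt0 h x y - if y = blk h x then 1 else 0) • pathsum (d0 g) (blk h x) (y - blk h x)
      = (wt0 h x y - if y = blk h x then 1 else 0) • (g y - g (blk h x)) := by
    intro y hy
    by_cases hys : y ∈ supp1 h x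
    · rw [pathsum_d0 g _ _ (fun a => ?_), add_sub_cancel]
      unfold supp1 at hys; rw [Fintype.mem_piFinset] at hys
      have := hys a; rw [mem_Icc] at this
      simp only [Pi.sub_apply]; omega
    · have h0 : wt0 h x y = 0 := wt0_eq_zero h hys
      have hne : y ≠ blk h x := fun e => hys (by rw [e]; unfold supp1; rw [Fintype.mem_piFinset]; intro a; rw [mem_Icc]; omega)
      rw [h0, if_neg hne, sub_zero, zero_smul, zero_smul]
  rw [sum_congr rfl hcoef]
  simp_rw [smul_sub, sub_smul, sum_sub_distrib, ite_smul, one_smul, zero_smul, sum_ite_eq' (win h x) (blk h x),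
    if_pos (blk_mem_win h x), ← sum_smul, sum_wt0_eq_one, one_smul]
  abel

end Summit.QuantumFields.YangMills.Theorems.DualWhitney
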